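import Literature.AlgebraicGeometry.Motives.HypersurfaceJacobianPresentation
import Literature.AlgebraicGeometry.Motives.GoodReductionSpecialFibreProofs
import Mathlib.Algebra.MvPolynomial.Division
import Mathlib.RingTheory.Localization.Ideal
import HarnessLib

/-!
# A coordinate hyperplane section of a smooth hypersurface chart is reduced

Let `k` be a field, `f ∈ k[y₀, …, y_{n+1}]`, `a₀` a variable and `j'` an index of the remaining
variables (`j = a₀.succAbove j'`), and let `S = k[y][1/∂ⱼf]` (any localisation of `k[y]` away from
`∂f/∂yⱼ`). The chart `Spec S/(f)` of the hypersurface `f = 0` is standard smooth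
(`Motives/HypersurfaceJacobianPresentation`). We prove that its **coordinate hyperplane section
`y_{a₀} = 0` is again such a chart, one dimension lower**, hence reduced:

* `killVar a₀ : k[y₀,…,y_{n+1}] → k[y'₀,…,y'ₙ]`, `y_{a₀} ↦ 0`, `y_{a₀.succAbove c} ↦ y'_c`
  (surjective, kernel `(y_{a₀})`, commutes with `∂/∂y_{a₀.succAbove j'} ↦ ∂/∂y'_{j'}`);
* `isLocalization_away_quotient_killVar` — `S/(y_{a₀}) = k[y'][1/∂_{j'} f']`, `f' = f(y_{a₀} := 0)`
  (Mathlib `IsLocalization.of_surjective`);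
* `isReduced_quotient_span_pair` — **`S/(y_{a₀}, f)` is reduced** (it is `k[y'][1/∂_{j'}f']/(f')`,
  standard smooth of relative dimension `n` by the Jacobian criterion, and smooth over a field is
  reduced).

This is the affine Jacobian criterion for the hyperplane section `{x_{k₀} = 0}` of a projective
hypersurface `V₊(F)` on the chart `D₊(xᵢ ∂ⱼF)`, `i, j ≠ k₀` (Hartshorne I Ex. 5.8 with
III Thm. 10.2), used for the Fermat varieties `Xⁿₘ = Xⁿ⁺¹ₘ ∩ {x_{n+2} = 0}` (Shioda–Katsura,
Tôhoku Math. J. 31 (1979), §1: the inductive structure; the ideal of `Xⁿₘ` in a chart of `Xⁿ⁺¹ₘ`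
is generated by the coordinate).

## References

* R. Hartshorne, *Algebraic Geometry*, GTM 52 (1977): I Ex. 5.8, III Thm. 10.2. [Hartshorne1977]
* T. Shioda, T. Katsura, On Fermat varieties, Tôhoku Math. J. 31 (1979) 97–115, §1.
  [ShiodaKatsura1979]
* The Stacks project, Tag 056T (smooth over a field is reduced). [StacksProject]
-/

noncomputable section

open MvPolynomial

universe u v

namespace Literature.AlgebraicGeometry.Motives.SmoothHypersurface

/-! ### Killing one variable -/

section KillVar

variable (k : Type u) [CommRing k] {n : ℕ} (a₀ : Fin (n + 2))

/-- **The substitution `y_{a₀} ↦ 0`**, `y_{a₀.succAbove c} ↦ y'_c`: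
`k[y₀, …, y_{n+1}] → k[y'₀, …, y'ₙ]`. [folklore] -/
def killVar : MvPolynomial (Fin (n + 2)) k →ₐ[k] MvPolynomial (Fin (n + 1)) k :=
  aeval (Fin.insertNth a₀ (0 : MvPolynomial (Fin (n + 1)) k) fun c ↦ X c)

/-- `y_{a₀} ↦ 0`. [folklore] -/
@[simp]
theorem killVar_X_self : killVar k a₀ (X a₀) = 0 := by
  rw [killVar, aeval_X, Fin.insertNth_apply_same]

/-- `y_{a₀.succAbove c} ↦ y'_c`. [folklore] -/
@[simp]
theorem killVar_X_succAbove (c : Fin (n + 1)) : killVar k a₀ (X (a₀.succAbove c)) = X c := by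
  rw [killVar, aeval_X, Fin.insertNth_apply_succAbove]

/-- `killVar` is a retraction of the inclusion `y'_c ↦ y_{a₀.succAbove c}`. [folklore] -/
theorem killVar_rename (p : MvPolynomial (Fin (n + 1)) k) :
    killVar k a₀ (rename a₀.succAbove p) = p := by
  rw [killVar, aeval_rename]
  conv_rhs => rw [← aeval_X_left_apply (R := k) p]
  congr 1
  ext1 c
  simp only [aeval_X, Function.comp_apply, Fin.insertNth_apply_succAbove]

/-- `killVar` is surjective. [folklore] -/
theorem killVar_surjective : Function.Surjective (killVar k a₀) :=
  fun p ↦ ⟨rename a₀.succAbove p, killVar_rename k a₀ p⟩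

/-- **The kernel of `y_{a₀} ↦ 0` is `(y_{a₀})`** (division with remainder by the monomial
`y_{a₀}`: the remainder does not involve `y_{a₀}`, so it is the image of a polynomial in the other
variables, on which `killVar` is injective). [folklore] -/
theorem ker_killVar : RingHom.ker (killVar k a₀) = Ideal.span {X a₀} := by
  apply le_antisymm
  · intro p hp
    rw [RingHom.mem_ker] at hp
    set q := p.divMonomial (Finsupp.single a₀ 1)
    set r := p.modMonomial (Finsupp.single a₀ 1)
    have hpr : X a₀ * q + r = p := divMonomial_add_modMonomial_single p a₀
    -- `r` does not involve `y_{a₀}`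
    have hvars : (↑r.vars : Set (Fin (n + 2))) ⊆ Set.range a₀.succAbove := by
      intro c hc
      rw [Fin.range_succAbove]
      rintro (rfl : c = a₀)
      obtain ⟨d, hd, hcd⟩ := (mem_vars_iff_mem_support c).mp (Finset.mem_coe.mp hc)
      have hle : Finsupp.single c 1 ≤ d := by
        rw [Finsupp.single_le_iff]
        exact Nat.one_le_iff_ne_zero.mpr (Finsupp.mem_support_iff.mp hcd)
      exact (mem_support_iff.mp hd) (coeff_modMonomial_of_le p hle)
    obtain ⟨r', hr'⟩ := exists_rename_eq_of_vars_subset_range r _ Fin.succAbove_right_injective hvars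
    have hr0 : r = 0 := by
      have h := hp
      rw [← hpr, map_add, map_mul, killVar_X_self, zero_mul, zero_add, ← hr', killVar_rename] at h
      rw [← hr', h, map_zero]
    rw [← hpr, hr0, add_zero]
    exact Ideal.mul_mem_right _ _ (Ideal.subset_span rfl)
  · rw [Ideal.span_le, Set.singleton_subset_iff, SetLike.mem_coe, RingHom.mem_ker]
    exact killVar_X_self k a₀

/-- **`killVar` commutes with partial derivatives in the surviving variables**:
`(∂p/∂y_{a₀.succAbove j'})(y_{a₀} := 0) = ∂(p(y_{a₀} := 0))/∂y'_{j'}`. [folklore] -/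
theorem killVar_pderiv_succAbove (j' : Fin (n + 1)) (p : MvPolynomial (Fin (n + 2)) k) :
    killVar k a₀ (pderiv (a₀.succAbove j') p) = pderiv j' (killVar k a₀ p) := by
  induction p using MvPolynomial.induction_on with
  | C c => simp [killVar]
  | add p q hp hq => rw [map_add, map_add, hp, map_add, map_add, hq]
  | mul_X p a hp =>
    -- `killVar (∂_{j} y_a) = ∂_{j'} (killVar y_a)`
    have key : killVar k a₀ (pderiv (a₀.succAbove j') (X a)) = pderiv j' (killVar k a₀ (X a)) := by
      rcases Fin.eq_self_or_eq_succAbove a₀ a with h | ⟨c, rfl⟩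
      · rw [h, killVar_X_self, map_zero, pderiv_X_of_ne (Fin.succAbove_ne a₀ j').symm, map_zero]
      · rw [killVar_X_succAbove]
        by_cases hc : j' = c
        · subst hc
          rw [pderiv_X_self, pderiv_X_self, map_one]
        · rw [pderiv_X_of_ne (Ne.symm hc),
            pderiv_X_of_ne (fun h ↦ hc (Fin.succAbove_right_injective h).symm), map_zero]
    rw [Derivation.leibniz, smul_eq_mul, smul_eq_mul, map_add, map_mul, map_mul, hp, key, map_mul,
      Derivation.leibniz, smul_eq_mul, smul_eq_mul]

end KillVar

/-! ### The hyperplane section of the chart: `S/(y_{a₀}) = k[y'][1/∂_{j'}f']` -/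

section Chart

variable (k : Type u) [CommRing k] {n : ℕ} (a₀ : Fin (n + 2)) (S : Type v) [CommRing S]
  [Algebra (MvPolynomial (Fin (n + 2)) k) S]

/-- The ideal `(y_{a₀}) S` of the hyperplane section in the chart ring `S`. [folklore] -/
abbrev hyperplaneIdeal : Ideal S :=
  Ideal.span {algebraMap (MvPolynomial (Fin (n + 2)) k) S (X a₀)}

/-- `ker killVar` as the kernel of the underlying ring homomorphism. [folklore] -/
theorem ker_killVar' : RingHom.ker (killVar k a₀).toRingHom = Ideal.span {X a₀} :=
  ker_killVar k a₀

/-- `(y_{a₀}) S` is the extension of the kernel of `killVar`. [folklore] -/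
theorem hyperplaneIdeal_eq_map :
    hyperplaneIdeal k a₀ S = (RingHom.ker (killVar k a₀)).map (algebraMap _ S) := by
  rw [ker_killVar, Ideal.map_span, Set.image_singleton]

/-- `(y_{a₀}) S` is the extension of the kernel of `killVar` (ring-hom form). [folklore] -/
theorem hyperplaneIdeal_eq_map' :
    hyperplaneIdeal k a₀ S = (RingHom.ker (killVar k a₀).toRingHom).map (algebraMap _ S) := by
  rw [ker_killVar', Ideal.map_span, Set.image_singleton]

/-- `k[y] → S → S/(y_{a₀}) S` kills `ker killVar = (y_{a₀})`. [folklore] -/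
theorem map_eq_zero_of_mem_ker_killVar :
    ∀ p ∈ RingHom.ker (killVar k a₀),
      ((Ideal.Quotient.mk (hyperplaneIdeal k a₀ S)).comp (algebraMap _ S)) p = 0 := fun p hp ↦ by
  rw [RingHom.comp_apply, Ideal.Quotient.eq_zero_iff_mem, hyperplaneIdeal_eq_map]
  exact Ideal.mem_map_of_mem _ hp

/-- The structure map `k[y'] → S/(y_{a₀})`: `k[y'] = k[y]/(y_{a₀}) → S/(y_{a₀}) S`. [folklore] -/
def quotientKillVarHom : MvPolynomial (Fin (n + 1)) k →+* S ⧸ hyperplaneIdeal k a₀ S :=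
  (Ideal.Quotient.lift (RingHom.ker (killVar k a₀))
      ((Ideal.Quotient.mk (hyperplaneIdeal k a₀ S)).comp (algebraMap _ S))
      (map_eq_zero_of_mem_ker_killVar k a₀ S)).comp
    (Ideal.quotientKerAlgEquivOfSurjective (killVar_surjective k a₀)).symm.toRingEquiv.toRingHom

/-- `quotientKillVarHom ∘ killVar = (S → S/(y_{a₀})) ∘ (k[y] → S)`. [folklore] -/
theorem quotientKillVarHom_killVar (p : MvPolynomial (Fin (n + 2)) k) :
    quotientKillVarHom k a₀ S (killVar k a₀ p) = Ideal.Quotient.mk _ (algebraMap _ S p) := by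
  have h1 : (Ideal.quotientKerAlgEquivOfSurjective (killVar_surjective k a₀)).symm (killVar k a₀ p) =
      Ideal.Quotient.mk _ p := Ideal.quotientKerAlgEquivOfSurjective_symm_apply _ p
  change Ideal.Quotient.lift (RingHom.ker (killVar k a₀))
    ((Ideal.Quotient.mk (hyperplaneIdeal k a₀ S)).comp (algebraMap _ S))
    (map_eq_zero_of_mem_ker_killVar k a₀ S)
    ((Ideal.quotientKerAlgEquivOfSurjective (killVar_surjective k a₀)).symm (killVar k a₀ p)) = _
  rw [h1, Ideal.Quotient.lift_mk, RingHom.comp_apply]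

/-- The `k[y']`-algebra structure on `S/(y_{a₀})` (local instance). [folklore] -/
abbrev quotientKillVarAlgebra : Algebra (MvPolynomial (Fin (n + 1)) k) (S ⧸ hyperplaneIdeal k a₀ S) :=
  (quotientKillVarHom k a₀ S).toAlgebra

attribute [local instance] quotientKillVarAlgebra

/-- `k → k[y'] → S/(y_{a₀})` is the structure map of the quotient. [folklore] -/
theorem isScalarTower_quotientKillVar [Algebra k S]
    [IsScalarTower k (MvPolynomial (Fin (n + 2)) k) S] :
    IsScalarTower k (MvPolynomial (Fin (n + 1)) k) (S ⧸ hyperplaneIdeal k a₀ S) := by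
  refine IsScalarTower.of_algebraMap_eq fun c ↦ ?_
  change algebraMap k (S ⧸ _) c =
    quotientKillVarHom k a₀ S (algebraMap k (MvPolynomial (Fin (n + 1)) k) c)
  rw [← (killVar k a₀).commutes c, quotientKillVarHom_killVar, ← IsScalarTower.algebraMap_apply,
    IsScalarTower.algebraMap_apply k S (S ⧸ hyperplaneIdeal k a₀ S) c, Ideal.Quotient.algebraMap_eq]

/-- **`S/(y_{a₀}) = k[y'][1/∂_{j'} f']`** with `f' = f(y_{a₀} := 0)`: the quotient of the
localisation `S = k[y][1/∂ⱼf]`, `j = a₀.succAbove j'`, by `y_{a₀}` is the localisation of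
`k[y'] = k[y]/(y_{a₀})` away from the image `∂_{j'}f'` of `∂ⱼf` (Mathlib
`IsLocalization.of_surjective`). [folklore] -/
theorem isLocalization_away_quotient_killVar (f : MvPolynomial (Fin (n + 2)) k) (j' : Fin (n + 1))
    [IsLocalization.Away (pderiv (a₀.succAbove j') f) S] :
    IsLocalization.Away (pderiv j' (killVar k a₀ f)) (S ⧸ hyperplaneIdeal k a₀ S) := by
  have h := IsLocalization.of_surjective (M := Submonoid.powers (pderiv (a₀.succAbove j') f))
    (S := S) (killVar k a₀).toRingHom (killVar_surjective k a₀)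
    (Ideal.Quotient.mk (hyperplaneIdeal k a₀ S)) Ideal.Quotient.mk_surjective
    (RingHom.ext fun p ↦ (quotientKillVarHom_killVar k a₀ S p).symm)
    (by rw [Ideal.mk_ker, hyperplaneIdeal_eq_map'])
  rw [Submonoid.map_powers] at h
  change IsLocalization (Submonoid.powers (killVar k a₀ _)) _ at h
  rwa [killVar_pderiv_succAbove] at h

end Chart

/-! ### The hyperplane section is reduced -/

section Reduced

variable (k : Type u) [Field k] {n : ℕ} (f : MvPolynomial (Fin (n + 2)) k) (a₀ : Fin (n + 2))
  (j' : Fin (n + 1)) (S : Type u) [CommRing S] [Algebra k S]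
  [Algebra (MvPolynomial (Fin (n + 2)) k) S] [IsScalarTower k (MvPolynomial (Fin (n + 2)) k) S]

attribute [local instance] quotientKillVarAlgebra

/-- **Jacobian criterion for the hyperplane section**: `S/(y_{a₀}) / (f̄)` is standard smooth of
relative dimension `n` over `k` (it is `k[y'][1/∂_{j'}f']/(f')`,
`Motives/HypersurfaceJacobianPresentation`). [cite: Hartshorne1977, I Ex. 5.8 and III Thm. 10.2] -/
theorem isStandardSmoothOfRelativeDimension_quotient_quotient
    [IsLocalization.Away (pderiv (a₀.succAbove j') f) S] :
    Algebra.IsStandardSmoothOfRelativeDimension n k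
      ((S ⧸ hyperplaneIdeal k a₀ S) ⧸ Ideal.span {Ideal.Quotient.mk (hyperplaneIdeal k a₀ S)
        (algebraMap (MvPolynomial (Fin (n + 2)) k) S f)}) := by
  haveI := isScalarTower_quotientKillVar k a₀ S
  haveI := isLocalization_away_quotient_killVar k a₀ S f j'
  have key := isStandardSmoothOfRelativeDimension_quotient (killVar k a₀ f) j'
    (S ⧸ hyperplaneIdeal k a₀ S)
  have halg : algebraMap (MvPolynomial (Fin (n + 1)) k) (S ⧸ hyperplaneIdeal k a₀ S)
      (killVar k a₀ f) = Ideal.Quotient.mk _ (algebraMap _ S f) :=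
    quotientKillVarHom_killVar k a₀ S f
  rwa [halg] at key

/-- **The coordinate hyperplane section `y_{a₀} = 0` of the smooth hypersurface chart
`Spec k[y][1/∂ⱼf]/(f)`, `j ≠ a₀`, is reduced**: `S/(y_{a₀}, f)` is reduced (smooth over a field ⇒
reduced, Stacks 056T). [cite: Hartshorne1977, I Ex. 5.8 and III Thm. 10.2]
[cite: StacksProject, Tag 056T] -/
theorem isReduced_quotient_span_pair [IsLocalization.Away (pderiv (a₀.succAbove j') f) S] :
    IsReduced (S ⧸ Ideal.span {algebraMap (MvPolynomial (Fin (n + 2)) k) S (X a₀),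
      algebraMap (MvPolynomial (Fin (n + 2)) k) S f}) := by
  haveI := isStandardSmoothOfRelativeDimension_quotient_quotient k f a₀ j' S
  haveI : IsReduced ((S ⧸ hyperplaneIdeal k a₀ S) ⧸ Ideal.span {Ideal.Quotient.mk
      (hyperplaneIdeal k a₀ S) (algebraMap (MvPolynomial (Fin (n + 2)) k) S f)}) :=
    isReduced_of_isStandardSmoothOfRelativeDimension k n
  -- `(S/(y)) / (f̄) ≅ S/(y, f)`
  have hmap : Ideal.span {Ideal.Quotient.mk (hyperplaneIdeal k a₀ S)
      (algebraMap (MvPolynomial (Fin (n + 2)) k) S f)} =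
      (Ideal.span {algebraMap (MvPolynomial (Fin (n + 2)) k) S f}).map
        (Ideal.Quotient.mk (hyperplaneIdeal k a₀ S)) := by
    rw [Ideal.map_span, Set.image_singleton]
  have hsup : hyperplaneIdeal k a₀ S ⊔ Ideal.span {algebraMap (MvPolynomial (Fin (n + 2)) k) S f} =
      Ideal.span {algebraMap (MvPolynomial (Fin (n + 2)) k) S (X a₀),
        algebraMap (MvPolynomial (Fin (n + 2)) k) S f} := by
    rw [hyperplaneIdeal, ← Ideal.span_union, Set.singleton_union]
  let e := ((Ideal.quotEquivOfEq hmap).trans (DoubleQuot.quotQuotEquivQuotSup _ _)).trans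
    (Ideal.quotEquivOfEq hsup)
  exact isReduced_of_injective e.symm.toRingHom e.symm.injective

end Reduced

end Literature.AlgebraicGeometry.Motives.SmoothHypersurface

end
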